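import Summits.BirchSwinnertonDyer.BirchSwinnertonDyer.Theorems.AlignedTransportAtTwoBSDOfMainConjectureRankOneAtTwoEulerCharAtTwoKerGCellBare
import Summits.BirchSwinnertonDyer.BirchSwinnertonDyer.Theorems.AlignedTransportAtTwoBSDOfMainConjectureRankOneAtTwoEulerCharAtTwoCellIndex
import Summits.BirchSwinnertonDyer.BirchSwinnertonDyer.Theorems.AlignedTransportAtTwoBSDOfMainConjectureRankOneAtTwoSigmaSqTwoExistence
import Literature.NumberTheory.DiophantineGeometry.LocalReductionFiniteBadPlacesProofs
import HarnessLib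

/-!
# Route `AlignedTransportAtTwo`, crux C3′ `BSDOfMainConjectureRankOneAtTwo` (stmt-BirchSwinnertonDyer-23008), line `birth` —
# THE CRUX BY NAME from (H″) «`#ker θ · log₂ 5 = u · #coker θ · Reg₂ · i_S` on the cell» + three published facts; and per cell curve (H″) ⟺ `BSD(W,2)`

HONEST FRAMING (cell `bsd-f1-sign2`, WIDTH-5 attach seat `bsd-line-att-p3` g13 under the C3′ lead lineage `bsd-line-att-p1`;
`--supports stmt-BirchSwinnertonDyer-23008 --as helper`). BSD is NOT proved; C3′ is NOT closed — (H″) is OPEN (Schneider's height comparison at `2`);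
this file closes the crux only CONDITIONALLY on it. THEOREMS ONLY (no `def`, no named fact, no `sorry`). Kernel form of the v11 skeleton proposal
`Cruxes/BSDOfMainConjectureRankOneAtTwo/Lines/birth_v11_bare_proposal_att_p3g13.lean` (whose stubs become hypotheses here).

* §1 `exists_finset_awayFrom_good` — a finite `S ⊇ {v ∣ p} ∪ {bad}` exists (glue; any number field).
* §2 `bareIdentityAt_iff_bsdp_of_cell` — for a cell curve `W` (`IsOrdinaryAt W 2`, no rational `2`-torsion abscissa, `r_an = 1`, `ord_T L₂(f_E) = 1`,
  `MazurMainConjecture W 2`) and any finite `S ⊇ {2} ∪ {bad}`, modulo PRINT {Disegni 2020 Thm 1 `hD`, GZK `hGZK`, modularity `hmod`} (the `Σ²` series at `2` is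
  the tree theorem `…SigmaSqTwo.mazurTate_sigmaSq_existsUnique_two_holds`): **(H″ at `W`, `S`) ⟺ `BSDp W 2`** (`…KerGCellBare.…_iff_bareIdentity_of_cell` ∘
  `…DisegniTight.leadingTermFormulaAtTwoAt_iff_bsdp`).
* §3 **`bsdOfMainConjectureRankOneAtTwo_of_bareIdentity`** — `BSDOfMainConjectureRankOneAtTwo` (the crux, BY NAME) from PRINT {`hD`, `hGZK`, `hmod`} and the ONE
  open statement (H″) quantified over the cell. CONDITIONAL (audit `proof.conditional`); the crux item stays open.

READING: C3′ ≡ (H″) on the cell, modulo three published facts — in both directions per curve. [cite: Disegni2020, Thm. 1] [cite: GrossZagier1986] [cite: Kolyvagin1990]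
[cite: BreuilConradDiamondTaylor2001] [cite: MazurTate1991, Thm. 3.1] [cite: PerrinRiou1992, §3.4] [cite: Schneider1985, §§6–8]
bears_on: stmt-BirchSwinnertonDyer-23008 (helper; closes nothing unconditionally), stmt-BirchSwinnertonDyer-22298 (attach seat's item; untouched).
-/

set_option autoImplicit false
-- the Theorems namespace of this sub repeats the summit name by design (D-0017 nested layout)
set_option linter.dupNamespace false

noncomputable section

open scoped Classical NumberField MatrixGroups ModularForm

open Field NumberField IsDedekindDomain Function WeierstrassCurve CongruenceSubgroup
open Literature.NumberTheory.EllipticCurves Literature.NumberTheory.EllipticCurves.GreenbergSelmer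
  Literature.NumberTheory.EllipticCurves.ModularForms
open Literature.NumberTheory.GaloisRepresentations
open Literature.NumberTheory.GaloisCohomology
open scoped ContRepresentation

namespace Summit.BirchSwinnertonDyer.BirchSwinnertonDyer.Theorems.AlignedTransportAtTwoEulerCharAtTwoKerGCellBareCrux

open Summit.BirchSwinnertonDyer.BirchSwinnertonDyer.Theorems.AlignedTransportAtTwoEulerCharAtTwoKerGCellBare
open ZpExtension Literature.NumberTheory.EllipticCurves.IwasawaAlgebra Literature.NumberTheory.EllipticCurves.IwasawaDual
open Literature.NumberTheory.EllipticCurves.Greenberg1999 Rat.HeightOneSpectrum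
open Summit.BirchSwinnertonDyer.BirchSwinnertonDyer.Theorems.Rank1ResidualX1Defs
open Summit.BirchSwinnertonDyer.BirchSwinnertonDyer.Theses.AlignedTransportAtTwo

/-! ## §1 Glue: a finite set of places containing the places above `p` and the bad places -/

/-- A finite set `S` of finite places off which `E` has good reduction and `v ∤ p` (the bad places and the places above `p` are finite).
[cite: SilvermanAEC2009, VIII.1 Remark 1.3] -/
theorem exists_finset_awayFrom_good {K : Type} [Field K] [NumberField K] (V : WeierstrassCurve K) [V.IsElliptic] (p : ℕ)
    [Fact p.Prime] : ∃ S : Finset (HeightOneSpectrum (𝓞 K)), ∀ v ∉ S, ((p : ℕ) : 𝓞 K) ∉ v.asIdeal ∧ V.HasGoodReductionAt v := by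
  classical
  have h1 : (V.badPlaces (𝓞 K)).Finite := V.finite_badPlaces_holds (𝓞 K)
  have hp0 : Ideal.span {((p : ℕ) : 𝓞 K)} ≠ ⊥ := by
    rw [Ne, Ideal.span_singleton_eq_bot]
    exact_mod_cast (Fact.out : p.Prime).ne_zero
  have h2 : {v : HeightOneSpectrum (𝓞 K) | ((p : ℕ) : 𝓞 K) ∈ v.asIdeal}.Finite := by
    refine (Ideal.finite_factors hp0).subset fun v hv ↦ ?_
    exact (Ideal.dvd_span_singleton).mpr hv
  refine ⟨(h1.union h2).toFinset, fun v hv ↦ ?_⟩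
  rw [Set.Finite.mem_toFinset, Set.mem_union, not_or] at hv
  refine ⟨hv.2, ?_⟩
  by_contra h
  exact hv.1 h

/-! ## §2 Per cell curve: (H″) ⟺ `BSD(W, 2)` modulo three published facts -/

variable (W : WeierstrassCurve ℚ) [W.IsElliptic] [W.IsGloballyMinimal]

/-- **PER CELL CURVE, (H″) ⟺ `BSDp W 2`** (modulo Disegni 2020 Thm 1 `hD`, GZK `hGZK`, modularity `hmod`; the `Σ²` division series at `2` is a tree theorem).
For `W/ℚ` globally minimal with `IsOrdinaryAt W 2`, no rational `2`-torsion abscissa, `r_an = 1`, `ord_T L₂(f_E) = 1`, `MazurMainConjecture W 2`, and any finite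
`S ⊇ {2} ∪ {bad}`: the bare height-index identity (H″) at `(W, S)` — «for every datum, `∃ u ∈ ℤ₂ˣ, #ker θ · log₂ 5 = u · #coker θ · Reg₂(Dh) · i_S`» — holds
IFF `BSDp W 2` (Miller's BSD(E,2)). (`…KerGCellBare.schneiderLeadingTermFormulaAtTwoSqAt_iff_bareIdentity_of_cell` ∘ `…DisegniTight.leadingTermFormulaAtTwoAt_iff_bsdp`.)
[cite: Disegni2020, Thm. 1] [cite: Miller2011LMS, Def. 1.1] [cite: MazurTate1991, Thm. 3.1] -/
theorem bareIdentityAt_iff_bsdp_of_cell (hD : Disegni2020.padicBSD_goodOrd_rankOne) (hGZK : rank_eq_analyticRank_of_analyticRank_le_one)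
    (hmod : nonempty_modularParametrizationData) (hord : IsOrdinaryAt W 2) (ht : ∀ x : ℚ, ¬ HasRationalTwoTorsionX W x)
    (hr : W.analyticRank = 1)
    (hL : ∀ [NeZero (W.conductorNorm ℤ)] (f : CuspForm (Gamma0 (W.conductorNorm ℤ)) 2), IsNewformOf W f →
      (padicLFunction f (unitRoot W 2 : ℚ_[2])).order = 1)
    (hMC : MazurMainConjecture W 2)
    (S : Finset (HeightOneSpectrum (𝓞 ℚ))) (hS : ∀ v ∉ S, ((2 : ℕ) : 𝓞 ℚ) ∉ v.asIdeal ∧ W.HasGoodReductionAt v) :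
    (∀ (κ : ZpExtension ℚ 2) (γ : Field.absoluteGaloisGroup ℚ),
        κ.IsCyclotomic → κ.IsTopGenerator γ → IsCyclotomicVariable 2 γ →
      ∀ (D : W.SelmerDualData κ γ) [Module.Finite (IwasawaAlgebra 2) D.X], D.IsTorsion →
      ∀ (Dh : PAdicHeightData W 2), Dh.IsCanonicalSq →
        SchneiderConjecture Dh → Finite (AddCommGroup.primaryComponent W.sha 2) →
      ∀ (e : ↥(W.selmerInfty κ ⊓ W.layerInvariants κ 0) ≃+ ↥(endInvariants (W.conjSelmerInfty κ γ - 1)))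
        (e₀ : ↥(W.selmerGroupPInfty 2) ≃+ ↥(W.selmerLayer κ 0))
        (M : Type) [AddCommGroup M] (kS : M →+ ↥(W.selmerGroupPInfty 2)), Function.Injective kS →
        Nat.card (↥(W.selmerGroupPInfty 2) ⧸ kS.range) = Nat.card (AddCommGroup.primaryComponent W.sha 2) →
      ∀ (θ : M →+ EndCoinvariants (W.conjSelmerInfty κ γ - 1)),
        θ = (W.selmerInftyEulerMap κ γ).comp
          (((e : ↥(W.selmerInfty κ ⊓ W.layerInvariants κ 0) →+ ↥(endInvariants (W.conjSelmerInfty κ γ - 1))).comp (W.sMap κ 0)).comp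
            ((e₀ : ↥(W.selmerGroupPInfty 2) →+ ↥(W.selmerLayer κ 0)).comp kS)) →
        ∃ u : ℤ_[2]ˣ,
          (Nat.card θ.ker : ℚ_[2]) * padicLog 2 (cyclotomicGenerator 2) =
            ((u : ℤ_[2]) : ℚ_[2]) * Nat.card (EndCoinvariants (W.conjSelmerInfty κ γ - 1) ⧸ θ.range) * padicRegulator Dh *
              (((∏ v ∈ S, Nat.card (W.localTowerKerPrimary κ (v.adicCompletion ℚ) 0)) / Nat.card (W.KerG κ 0) : ℕ) : ℚ_[2])) ↔
    BSDp W 2 := by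
  have h2 := AlignedTransportAtTwoEulerCharAtTwoCellIndex.not_two_dvd_torsionOrder_of_forall_not_hasRationalTwoTorsionX W ht
  have hK : ∀ P : W.toAffine.Point, 2 • P = 0 → P = 0 := fun P hP ↦
    Summit.BirchSwinnertonDyer.Rank1Residual.Iwasawa.forall_smul_eq_zero_imp_of_not_dvd_torsionOrder W h2 P (by convert hP)
  refine (schneiderLeadingTermFormulaAtTwoSqAt_iff_bareIdentity_of_cell W hGZK hmod hord hK hr hL hMC S hS).symm.trans ?_
  refine Iff.trans ?_ (AlignedTransportAtTwoDisegniTight.leadingTermFormulaAtTwoAt_iff_bsdp hD hGZK hmod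
    AlignedTransportAtTwoSigmaSqTwo.mazurTate_sigmaSq_existsUnique_two_holds W hord hr hL hMC)
  exact ⟨fun h ↦ h hord.1 hord.2, fun h _ _ ↦ h⟩

/-! ## §3 The crux BY NAME from (H″) on the cell + three published facts -/

/-- **C3′ `BSDOfMainConjectureRankOneAtTwo` FROM (H″) + PRINT (CONDITIONAL; the item stays open).** Granted Disegni 2020 Thm 1 (`hD`), GZK (`hGZK`), modularity
(`hmod`) and the ONE open statement (H″) — «for every cell curve `W` (good ordinary at `2`, `E(ℚ)[2] = 0`, `r_an = 1`, `ord_T L₂(f_E) = 1`, `MazurMainConjecture W 2`),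
every finite `S ⊇ {2} ∪ {bad}` and every datum: `∃ u ∈ ℤ₂ˣ, #ker θ · log₂ 5 = u · #coker θ · Reg₂(Dh) · i_S`» — the crux holds BY NAME. The binders `¬ HasCM` and
`Δ ∉ ℚ²` of the crux are not used. This is the composition of the v11 skeleton proposal with its stubs as hypotheses.
[cite: Disegni2020, Thm. 1] [cite: PerrinRiou1992, §3.4 (p odd; the p = 2 statement (H″) is the cell's open obligation)] -/
theorem bsdOfMainConjectureRankOneAtTwo_of_bareIdentity (hD : Disegni2020.padicBSD_goodOrd_rankOne)
    (hGZK : rank_eq_analyticRank_of_analyticRank_le_one) (hmod : nonempty_modularParametrizationData)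
    (hH : ∀ (W : WeierstrassCurve ℚ) [W.IsElliptic] [W.IsGloballyMinimal],
      IsOrdinaryAt W 2 → (∀ P : W.toAffine.Point, 2 • P = 0 → P = 0) → W.analyticRank = 1 →
      (∀ [NeZero (W.conductorNorm ℤ)] (f : CuspForm (Gamma0 (W.conductorNorm ℤ)) 2), IsNewformOf W f →
        (padicLFunction f (unitRoot W 2 : ℚ_[2])).order = 1) →
      MazurMainConjecture W 2 →
      ∀ (S : Finset (HeightOneSpectrum (𝓞 ℚ))), (∀ v ∉ S, ((2 : ℕ) : 𝓞 ℚ) ∉ v.asIdeal ∧ W.HasGoodReductionAt v) →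
      ∀ (κ : ZpExtension ℚ 2) (γ : Field.absoluteGaloisGroup ℚ),
        κ.IsCyclotomic → κ.IsTopGenerator γ → IsCyclotomicVariable 2 γ →
      ∀ (D : W.SelmerDualData κ γ) [Module.Finite (IwasawaAlgebra 2) D.X], D.IsTorsion →
      ∀ (Dh : PAdicHeightData W 2), Dh.IsCanonicalSq →
        SchneiderConjecture Dh → Finite (AddCommGroup.primaryComponent W.sha 2) →
      ∀ (e : ↥(W.selmerInfty κ ⊓ W.layerInvariants κ 0) ≃+ ↥(endInvariants (W.conjSelmerInfty κ γ - 1)))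
        (e₀ : ↥(W.selmerGroupPInfty 2) ≃+ ↥(W.selmerLayer κ 0))
        (M : Type) [AddCommGroup M] (kS : M →+ ↥(W.selmerGroupPInfty 2)), Function.Injective kS →
        Nat.card (↥(W.selmerGroupPInfty 2) ⧸ kS.range) = Nat.card (AddCommGroup.primaryComponent W.sha 2) →
      ∀ (θ : M →+ EndCoinvariants (W.conjSelmerInfty κ γ - 1)),
        θ = (W.selmerInftyEulerMap κ γ).comp
          (((e : ↥(W.selmerInfty κ ⊓ W.layerInvariants κ 0) →+ ↥(endInvariants (W.conjSelmerInfty κ γ - 1))).comp (W.sMap κ 0)).comp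
            ((e₀ : ↥(W.selmerGroupPInfty 2) →+ ↥(W.selmerLayer κ 0)).comp kS)) →
        ∃ u : ℤ_[2]ˣ,
          (Nat.card θ.ker : ℚ_[2]) * padicLog 2 (cyclotomicGenerator 2) =
            ((u : ℤ_[2]) : ℚ_[2]) * Nat.card (EndCoinvariants (W.conjSelmerInfty κ γ - 1) ⧸ θ.range) * padicRegulator Dh *
              (((∏ v ∈ S, Nat.card (W.localTowerKerPrimary κ (v.adicCompletion ℚ) 0)) / Nat.card (W.KerG κ 0) : ℕ) : ℚ_[2])) :
    BSDOfMainConjectureRankOneAtTwo := by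
  intro W _ _ _hcm hord ht _hsq hr hL hMC
  have h2 := AlignedTransportAtTwoEulerCharAtTwoCellIndex.not_two_dvd_torsionOrder_of_forall_not_hasRationalTwoTorsionX W ht
  have hK : ∀ P : W.toAffine.Point, 2 • P = 0 → P = 0 := fun P hP ↦
    Summit.BirchSwinnertonDyer.Rank1Residual.Iwasawa.forall_smul_eq_zero_imp_of_not_dvd_torsionOrder W h2 P (by convert hP)
  obtain ⟨S, hS⟩ := exists_finset_awayFrom_good W 2
  exact (bareIdentityAt_iff_bsdp_of_cell W hD hGZK hmod hord ht hr hL hMC S hS).mp (hH W hord hK hr hL hMC S hS)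

end Summit.BirchSwinnertonDyer.BirchSwinnertonDyer.Theorems.AlignedTransportAtTwoEulerCharAtTwoKerGCellBareCrux

end
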